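import Literature.Analysis.FunctionSpaces.SobolevBallScaling
import Literature.Analysis.FunctionSpaces.PoincareGluing
import HarnessLib

/-!
# Multiscale Poincaré on balls for `W^{1,2}` fields (route `EulerZoomLiouville`, crux
# `PowerGaugeEulerLiouville` = stmt-NavierStokesRegularity-19832, line `birth`, stub
# `stub_backwardVanishing` — the deterministic slice estimate)

Helper file (theorems only).  The registered stub `stub_backwardVanishing` of the birth skeleton
of the crux says: every member of Seregin's power-gauged ancient Euler class (`ρ > 0`) VANISHES
BACKWARD on fixed balls along density-one sets of times.  Its proof has two halves: Chebyshev in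
time under the gauged enstrophy bound (file `…BackwardChebyshev`), and — this file — a purely
spatial estimate for ONE slice `f = u(τ) ∈ W^{1,2}(B(x₀, 2ⁿR))` with weak gradient `g`:

  `‖f‖_{L²(B_R)} ≤ K · R · ‖g‖_{L²(B_{2ⁿR})} + |B_R|^{1/2} · ‖⨍_{B_{2ⁿR}} f‖`      (`eLpNorm_ball_le_multiscale`)

with an ABSOLUTE constant `K` (independent of `R`, `n`, `x₀`).  Mechanism ("multiscale Poincaré",
telescoping of means over the dyadic balls `B_k = B(x₀, 2ᵏR)`):

* `exists_poincare_two_ball` — the scale-invariant `L²` Poincaré inequality on balls of `ℝ³`,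
  `‖f - ⨍_B f‖_{L²(B)} ≤ C_P r ‖g‖_{L²(B)}`, from the tree's Poincaré–Sobolev inequality
  `exists_eLpNorm_sub_average_le_ball` at `p = 6/5 → p' = 2` and Hölder `L² ⊂ L^{6/5}` on `B`
  (`|B(x₀,r)|^{1/3} = |B₁|^{1/3} r`);
* `enorm_average_sub_average_mul_le` — Jensen: `‖⨍_{B_ρ} f - ⨍_{B_σ} f‖ · |B_ρ|^{1/2} ≤
  ‖f - ⨍_{B_σ} f‖_{L²(B_σ)}` for `ρ ≤ σ`;
* the dyadic chain: `‖m_k - m_{k+1}‖ |B_k|^{1/2} ≤ C_P 2^{k+1} R ‖g‖₂`, `|B_k| = 8ᵏ|B_R|`, so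
  `‖m_0‖ |B_R|^{1/2} ≤ 2 C_P R ‖g‖₂ Σ_k 2^{-k/2} + ‖m_n‖ |B_R|^{1/2}` and `Σ_k 2^{-k/2} ≤ 4`.

In the stub, `‖g‖_{L²(B_{2ⁿR})}² ≤ λ_a → 0` off a sparse set of times (Chebyshev under the `E`-gauge)
and `‖⨍_{B_{2ⁿR}} f‖ ≲ a^{-1-ρ} → 0` by the `A`-gauge, so `‖u(τ)‖_{L²(B_R)} → 0` along density-one
times.  Pure real analysis over the tree's Sobolev classes (`MemLp`, `HasWeakFDerivOn`).
WHAT THIS IS NOT: not NS / Euler — no equation is used here. [folklore]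
-/

noncomputable section

-- the summit and its single problem share the name `NavierStokesRegularity` (D-0017 nested layout)
set_option linter.dupNamespace false

open MeasureTheory Set Filter Topology Metric Module TopologicalSpace
open scoped NNReal ENNReal

namespace Summit.NavierStokesRegularity.NavierStokesRegularity.Theorems.PowerGaugeEulerLiouville.Backward

open Literature.Analysis Literature.Analysis.FunctionSpaces

/-! ## The `L²` Poincaré inequality on balls of `ℝ³` -/

/-- Volume of a ball of `ℝ³`: `|B(x₀, r)| = r³ |B₁|`. [folklore] -/
theorem volume_ball_eq (x₀ : EuclideanSpace ℝ (Fin 3)) {r : ℝ} (hr : 0 < r) :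
    volume (ball x₀ r) = ENNReal.ofReal r ^ 3 * volume (ball (0 : EuclideanSpace ℝ (Fin 3)) 1) := by
  rw [Measure.addHaar_ball_of_pos volume x₀ hr, finrank_euclideanSpace_fin, ENNReal.ofReal_pow hr.le]

/-- Components of an `L²` field of linear maps are `L²`. [folklore] -/
theorem memLp_clm_apply {μ : Measure (EuclideanSpace ℝ (Fin 3))}
    {g : EuclideanSpace ℝ (Fin 3) → EuclideanSpace ℝ (Fin 3) →L[ℝ] EuclideanSpace ℝ (Fin 3)}
    {p : ℝ≥0∞} (hg : MemLp g p μ) (v : EuclideanSpace ℝ (Fin 3)) :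
    MemLp (fun x => g x v) p μ := by
  refine MemLp.of_le_mul (c := ‖v‖) hg
    ((ContinuousLinearMap.apply ℝ (EuclideanSpace ℝ (Fin 3)) v).continuous.comp_aestronglyMeasurable
      hg.1) (Eventually.of_forall fun x => ?_)
  rw [mul_comm]
  exact (g x).le_opNorm v

/-- **The scale-invariant `L²` Poincaré inequality on balls of `ℝ³`.**  There is an absolute `C`
such that for every ball `B = B(x₀, r)` and every `f ∈ L²(B; ℝ³)` with a weak derivative
`g ∈ L²(B)` on `B`: `‖f - ⨍_B f‖_{L²(B)} ≤ C · r · ‖g‖_{L²(B)}`.  From the tree's Poincaré–Sobolev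
inequality on balls (`exists_eLpNorm_sub_average_le_ball`, `p = 6/5`, `p' = 2`, constant independent
of the ball) and Hölder `‖g‖_{L^{6/5}(B)} ≤ |B|^{1/3} ‖g‖_{L²(B)}`, `|B|^{1/3} = |B₁|^{1/3} r`.
[folklore] -/
theorem exists_poincare_two_ball :
    ∃ C : ℝ≥0∞, C ≠ ⊤ ∧ ∀ (x₀ : EuclideanSpace ℝ (Fin 3)) (r : ℝ), 0 < r →
      ∀ (f : EuclideanSpace ℝ (Fin 3) → EuclideanSpace ℝ (Fin 3))
        (g : EuclideanSpace ℝ (Fin 3) → EuclideanSpace ℝ (Fin 3) →L[ℝ] EuclideanSpace ℝ (Fin 3)),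
      MemLp f 2 (volume.restrict (ball x₀ r)) → MemLp g 2 (volume.restrict (ball x₀ r)) →
      HasWeakFDerivOn (⟨ball x₀ r, isOpen_ball⟩ : Opens (EuclideanSpace ℝ (Fin 3))) volume f g →
      eLpNorm (fun x => f x - ⨍ y in ball x₀ r, f y) 2 (volume.restrict (ball x₀ r)) ≤
        C * ENNReal.ofReal r * eLpNorm g 2 (volume.restrict (ball x₀ r)) := by
  have h3 : finrank ℝ (EuclideanSpace ℝ (Fin 3)) = 3 := finrank_euclideanSpace_fin
  obtain ⟨C, hC⟩ := exists_eLpNorm_sub_average_le_ball (E := EuclideanSpace ℝ (Fin 3))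
    (F := EuclideanSpace ℝ (Fin 3)) (p := 6 / 5) (p' := 2)
    (NNReal.coe_le_coe.mp (by push_cast; norm_num))
    (by rw [h3]; push_cast; norm_num) (by rw [h3]; push_cast; norm_num)
  set V₁ : ℝ≥0∞ := volume (ball (0 : EuclideanSpace ℝ (Fin 3)) 1) with hV₁
  have hV₁top : V₁ ≠ ⊤ := measure_ball_lt_top.ne
  refine ⟨(C : ℝ≥0∞) * V₁ ^ (1 / 3 : ℝ), ENNReal.mul_ne_top ENNReal.coe_ne_top
    (ENNReal.rpow_ne_top_of_nonneg (by norm_num) hV₁top), ?_⟩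
  intro x₀ r hr f g hf hg hW
  haveI : IsFiniteMeasure (volume.restrict (ball x₀ r)) :=
    isFiniteMeasure_restrict.2 measure_ball_lt_top.ne
  have h65 : ((6 / 5 : ℝ≥0) : ℝ≥0∞) ≤ 2 := by
    rw [ENNReal.coe_div (by norm_num)]
    norm_num
    rw [ENNReal.div_le_iff (by norm_num) (by norm_num)]
    norm_num
  have hfW : MemSobolevDomain 1 ((6 / 5 : ℝ≥0) : ℝ≥0∞)
      (⟨ball x₀ r, isOpen_ball⟩ : Opens (EuclideanSpace ℝ (Fin 3))) volume f := by
    refine (memSobolevDomain_succ_iff (k := 0)).2 ⟨hf.mono_exponent h65, g, hW, fun v => ?_⟩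
    rw [memSobolevDomain_zero_iff]
    exact (memLp_clm_apply hg v).mono_exponent h65
  have h1 := hC x₀ r hr f g hfW hW
  have h2 : eLpNorm g ((6 / 5 : ℝ≥0) : ℝ≥0∞) (volume.restrict (ball x₀ r)) ≤
      eLpNorm g 2 (volume.restrict (ball x₀ r)) *
        (volume.restrict (ball x₀ r)) univ ^ (1 / ((6 / 5 : ℝ≥0) : ℝ≥0∞).toReal - 1 / (2 : ℝ≥0∞).toReal) :=
    eLpNorm_le_eLpNorm_mul_rpow_measure_univ h65 hg.1
  have hexp : 1 / ((6 / 5 : ℝ≥0) : ℝ≥0∞).toReal - 1 / (2 : ℝ≥0∞).toReal = (1 / 3 : ℝ) := by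
    rw [ENNReal.coe_toReal]
    push_cast
    norm_num
  have hvol : (volume.restrict (ball x₀ r)) univ ^ (1 / 3 : ℝ) = ENNReal.ofReal r * V₁ ^ (1 / 3 : ℝ) := by
    rw [Measure.restrict_apply_univ, volume_ball_eq x₀ hr, ENNReal.mul_rpow_of_nonneg _ _ (by norm_num),
      ← ENNReal.rpow_natCast, ← ENNReal.rpow_mul]
    norm_num
    rfl
  rw [hexp, hvol] at h2
  have e2 : ((2 : ℝ≥0) : ℝ≥0∞) = 2 := rfl
  rw [e2] at h1
  calc eLpNorm (fun x => f x - ⨍ y in ball x₀ r, f y) 2 (volume.restrict (ball x₀ r))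
      ≤ C * eLpNorm g ((6 / 5 : ℝ≥0) : ℝ≥0∞) (volume.restrict (ball x₀ r)) := h1
    _ ≤ C * (eLpNorm g 2 (volume.restrict (ball x₀ r)) * (ENNReal.ofReal r * V₁ ^ (1 / 3 : ℝ))) := by
        gcongr
    _ = (C : ℝ≥0∞) * V₁ ^ (1 / 3 : ℝ) * ENNReal.ofReal r * eLpNorm g 2 (volume.restrict (ball x₀ r)) := by
        ring

/-! ## Jensen: differences of means against the Poincaré deviation -/

/-- **Jensen for the difference of two ball means.**  For `B_ρ ⊆ B_σ` (same centre, `0 < ρ ≤ σ`)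
and `f` integrable on `B_σ`:
`‖⨍_{B_ρ} f - ⨍_{B_σ} f‖ · |B_ρ|^{1/2} ≤ ‖f - ⨍_{B_σ} f‖_{L²(B_σ)}`
(the difference of means is the `B_ρ`-mean of `f - ⨍_{B_σ} f`; Hölder for averages,
`enorm_setAverage_mul_rpow_le`). [folklore] -/
theorem enorm_average_sub_average_mul_le {x₀ : EuclideanSpace ℝ (Fin 3)} {ρ σ : ℝ} (hρ : 0 < ρ)
    (hρσ : ρ ≤ σ) {f : EuclideanSpace ℝ (Fin 3) → EuclideanSpace ℝ (Fin 3)}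
    (hf : IntegrableOn f (ball x₀ σ) volume)
    (hfm : AEStronglyMeasurable f (volume.restrict (ball x₀ σ))) :
    ‖(⨍ y in ball x₀ ρ, f y) - ⨍ y in ball x₀ σ, f y‖ₑ * volume (ball x₀ ρ) ^ (1 / 2 : ℝ) ≤
      eLpNorm (fun x => f x - ⨍ y in ball x₀ σ, f y) 2 (volume.restrict (ball x₀ σ)) := by
  have hsub : ball x₀ ρ ⊆ ball x₀ σ := ball_subset_ball hρσ
  have hρ0 : volume (ball x₀ ρ) ≠ 0 := (measure_ball_pos volume x₀ hρ).ne'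
  have hρt : volume (ball x₀ ρ) ≠ ⊤ := measure_ball_lt_top.ne
  have hfρ : IntegrableOn f (ball x₀ ρ) volume := hf.mono_set hsub
  -- the difference of means is the small-ball mean of `f - ⨍_{B_σ} f`
  have hmean : (⨍ y in ball x₀ ρ, f y) - ⨍ y in ball x₀ σ, f y =
      ⨍ y in ball x₀ ρ, (f y - ⨍ z in ball x₀ σ, f z) := by
    rw [setAverage_eq, setAverage_eq (f := fun y => f y - ⨍ z in ball x₀ σ, f z),
      integral_sub hfρ (integrableOn_const hρt), setIntegral_const, smul_sub]
    congr 1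
    rw [measureReal_def, ← smul_assoc, smul_eq_mul, inv_mul_cancel₀ (ENNReal.toReal_ne_zero.2 ⟨hρ0, hρt⟩),
      one_smul]
  rw [hmean]
  have hJ := FunctionSpaces.enorm_setAverage_mul_rpow_le (μ := volume) (s := ball x₀ ρ) hρt
    (p := 2) (by norm_num) (h := fun y => f y - ⨍ z in ball x₀ σ, f z)
    ((hfm.mono_measure (Measure.restrict_mono hsub le_rfl)).sub aestronglyMeasurable_const)
  have e2 : (1 / (2 : ℝ≥0∞).toReal : ℝ) = 1 / 2 := by norm_num
  rw [e2] at hJ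
  exact hJ.trans (eLpNorm_mono_measure _ (Measure.restrict_mono hsub le_rfl))

/-! ## The multiscale estimate -/

/-- `(4ᵏ)³ = (8ᵏ)²` in `ℝ≥0∞`. [folklore] -/
theorem pow_four_cube_eq (k : ℕ) : ((4 : ℝ≥0∞) ^ k) ^ 3 = ((8 : ℝ≥0∞) ^ k) ^ 2 := by
  rw [← pow_mul, ← pow_mul, pow_mul' (4 : ℝ≥0∞), pow_mul' (8 : ℝ≥0∞)]
  norm_num

/-- `2⁻¹ · 8 = 4` in `ℝ≥0∞`. [folklore] -/
theorem inv_two_mul_eight : (2 : ℝ≥0∞)⁻¹ * 8 = 4 := by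
  rw [show (8 : ℝ≥0∞) = 2 * 4 by norm_num, ← mul_assoc,
    ENNReal.inv_mul_cancel two_ne_zero ENNReal.ofNat_ne_top, one_mul]

/-- `∑_{k<n} 2⁻ᵏ ≤ 2` in `ℝ≥0∞`. [folklore] -/
theorem sum_inv_two_pow_le (n : ℕ) : ∑ k ∈ Finset.range n, ((2 : ℝ≥0∞)⁻¹) ^ k ≤ 2 := by
  refine (ENNReal.sum_le_tsum _).trans ?_
  rw [ENNReal.tsum_geometric, ENNReal.one_sub_inv_two, inv_inv]

/-- **Multiscale Poincaré on balls.**  There is an absolute `K < ∞` such that for every centre `x₀`,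
radius `R > 0`, number of dyadic steps `n`, and every `f ∈ L²(B(x₀, 4ⁿR); ℝ³)` with a weak
derivative `g ∈ L²(B(x₀, 4ⁿR))` there:
`‖f‖_{L²(B_R)} ≤ K · R · ‖g‖_{L²(B_{4ⁿR})} + ‖⨍_{B_{4ⁿR}} f‖ · |B_R|^{1/2}`.
Proof: with `m_k = ⨍_{B(x₀, 4ᵏR)} f`, Jensen + Poincaré on `B_{k+1}` give
`‖m_k - m_{k+1}‖ |B_k|^{1/2} ≤ C_P 4^{k+1} R ‖g‖₂`, and `|B_k|^{1/2} = 8ᵏ |B_R|^{1/2}`, so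
`‖m_k - m_{k+1}‖ |B_R|^{1/2} ≤ 4 C_P R ‖g‖₂ 2^{-k}`; telescoping (`∑ 2^{-k} ≤ 2`) bounds
`‖m_0‖ |B_R|^{1/2} ≤ 8 C_P R ‖g‖₂ + ‖m_n‖ |B_R|^{1/2}`, and `‖f‖_{L²(B_R)} ≤ C_P R ‖g‖₂ + ‖m_0‖ |B_R|^{1/2}`
(`K = 9 C_P`). [folklore] -/
theorem exists_eLpNorm_ball_le_multiscale :
    ∃ K : ℝ≥0∞, K ≠ ⊤ ∧ ∀ (x₀ : EuclideanSpace ℝ (Fin 3)) (R : ℝ), 0 < R → ∀ (n : ℕ)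
      (f : EuclideanSpace ℝ (Fin 3) → EuclideanSpace ℝ (Fin 3))
      (g : EuclideanSpace ℝ (Fin 3) → EuclideanSpace ℝ (Fin 3) →L[ℝ] EuclideanSpace ℝ (Fin 3)),
      MemLp f 2 (volume.restrict (ball x₀ (4 ^ n * R))) →
      MemLp g 2 (volume.restrict (ball x₀ (4 ^ n * R))) →
      HasWeakFDerivOn (⟨ball x₀ (4 ^ n * R), isOpen_ball⟩ : Opens (EuclideanSpace ℝ (Fin 3)))
        volume f g →
      eLpNorm f 2 (volume.restrict (ball x₀ R)) ≤
        K * ENNReal.ofReal R * eLpNorm g 2 (volume.restrict (ball x₀ (4 ^ n * R))) +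
          ‖⨍ y in ball x₀ (4 ^ n * R), f y‖ₑ * volume (ball x₀ R) ^ (1 / 2 : ℝ) := by
  obtain ⟨C, hCtop, hC⟩ := exists_poincare_two_ball
  refine ⟨9 * C, ENNReal.mul_ne_top (by norm_num) hCtop, ?_⟩
  intro x₀ R hR n f g hf hg hW
  -- ## radii, measures, restrictions
  set r : ℕ → ℝ := fun k => 4 ^ k * R with hr
  have hrpos : ∀ k, 0 < r k := fun k => by positivity
  have hrmono : ∀ {k l : ℕ}, k ≤ l → r k ≤ r l := fun {k l} hkl =>
    mul_le_mul_of_nonneg_right (pow_le_pow_right₀ (by norm_num) hkl) hR.le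
  have hr0 : r 0 = R := by simp [hr]
  set μ : ℕ → Measure (EuclideanSpace ℝ (Fin 3)) := fun k => volume.restrict (ball x₀ (r k)) with hμ
  have hμmono : ∀ {k l : ℕ}, k ≤ l → μ k ≤ μ l := fun hkl =>
    Measure.restrict_mono (ball_subset_ball (hrmono hkl)) le_rfl
  have hfk : ∀ k, k ≤ n → MemLp f 2 (μ k) := fun k hk => hf.mono_measure (hμmono hk)
  have hgk : ∀ k, k ≤ n → MemLp g 2 (μ k) := fun k hk => hg.mono_measure (hμmono hk)
  have hWk : ∀ k, k ≤ n →
      HasWeakFDerivOn (⟨ball x₀ (r k), isOpen_ball⟩ : Opens (EuclideanSpace ℝ (Fin 3))) volume f g :=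
    fun k hk => HasWeakFDerivOn.mono_set_holds hW (ball_subset_ball (hrmono hk))
  haveI hfin : ∀ k, IsFiniteMeasure (μ k) := fun k =>
    isFiniteMeasure_restrict.2 measure_ball_lt_top.ne
  have hint : ∀ k, k ≤ n → IntegrableOn f (ball x₀ (r k)) volume := fun k hk =>
    (hfk k hk).integrable one_le_two
  -- ## means, the top gradient norm, the half-volume of `B_R`
  set m : ℕ → EuclideanSpace ℝ (Fin 3) := fun k => ⨍ y in ball x₀ (r k), f y with hm
  set L : ℝ≥0∞ := eLpNorm g 2 (μ n) with hL
  set W : ℝ≥0∞ := volume (ball x₀ R) ^ (1 / 2 : ℝ) with hWdef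
  -- `|B_k|^{1/2} = 8ᵏ |B_R|^{1/2}`
  have hvolk : ∀ k, volume (ball x₀ (r k)) ^ (1 / 2 : ℝ) = 8 ^ k * W := by
    intro k
    have h1 : volume (ball x₀ (r k)) = ((8 : ℝ≥0∞) ^ k) ^ 2 * volume (ball x₀ R) := by
      rw [volume_ball_eq x₀ (hrpos k), volume_ball_eq x₀ hR, ← mul_assoc, ← pow_four_cube_eq]
      congr 1
      simp only [hr]
      rw [ENNReal.ofReal_mul (by positivity), mul_pow, ENNReal.ofReal_pow (by norm_num) k]
      norm_num
    rw [h1, ENNReal.mul_rpow_of_nonneg _ _ (by norm_num), hWdef]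
    congr 1
    rw [← ENNReal.rpow_natCast, ← ENNReal.rpow_mul]
    norm_num
  -- ## one dyadic step: `‖m_k - m_{k+1}‖ |B_R|^{1/2} ≤ 4 C R L 2^{-k}`
  have hstep : ∀ k, k < n →
      ‖m k - m (k + 1)‖ₑ * W ≤ 4 * C * ENNReal.ofReal R * L * ((2 : ℝ≥0∞)⁻¹) ^ k := by
    intro k hk
    have hk1 : k + 1 ≤ n := hk
    have hJ := enorm_average_sub_average_mul_le (x₀ := x₀) (hrpos k) (hrmono (Nat.le_succ k))
      (hint (k + 1) hk1) (hfk (k + 1) hk1).1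
    have hP := hC x₀ (r (k + 1)) (hrpos (k + 1)) f g (hfk (k + 1) hk1) (hgk (k + 1) hk1)
      (hWk (k + 1) hk1)
    have hLk : eLpNorm g 2 (μ (k + 1)) ≤ L := eLpNorm_mono_measure _ (hμmono hk1)
    have h1 : ‖m k - m (k + 1)‖ₑ * (8 ^ k * W) ≤ C * ENNReal.ofReal (r (k + 1)) * L := by
      rw [← hvolk k]
      exact hJ.trans (hP.trans (by gcongr))
    have h2 : ENNReal.ofReal (r (k + 1)) = 4 * 4 ^ k * ENNReal.ofReal R := by
      simp only [hr]
      rw [ENNReal.ofReal_mul (by positivity), ENNReal.ofReal_pow (by norm_num) (k + 1), pow_succ]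
      norm_num
      ring
    rw [h2] at h1
    -- cancel `8ᵏ = 2ᵏ·4ᵏ`: multiply the target by `8ᵏ`
    have h8 : ((2 : ℝ≥0∞)⁻¹) ^ k * 8 ^ k = 4 ^ k := by
      rw [← mul_pow, inv_two_mul_eight]
    have h80 : (8 : ℝ≥0∞) ^ k ≠ 0 := pow_ne_zero _ (by norm_num)
    have h8t : (8 : ℝ≥0∞) ^ k ≠ ⊤ := ENNReal.pow_ne_top ENNReal.ofNat_ne_top
    rw [← ENNReal.mul_le_mul_iff_left h80 h8t]
    calc ‖m k - m (k + 1)‖ₑ * W * 8 ^ k = ‖m k - m (k + 1)‖ₑ * (8 ^ k * W) := by ring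
      _ ≤ C * (4 * 4 ^ k * ENNReal.ofReal R) * L := h1
      _ = 4 * C * ENNReal.ofReal R * L * (((2 : ℝ≥0∞)⁻¹) ^ k * 8 ^ k) := by rw [h8]; ring
      _ = 4 * C * ENNReal.ofReal R * L * ((2 : ℝ≥0∞)⁻¹) ^ k * 8 ^ k := by ring
  -- ## telescoping: `‖m_0 - m_n‖ |B_R|^{1/2} ≤ 8 C R L`
  have htel : ‖m 0 - m n‖ₑ * W ≤ 8 * C * ENNReal.ofReal R * L := by
    have h1 : ‖m 0 - m n‖ₑ ≤ ∑ k ∈ Finset.range n, ‖m k - m (k + 1)‖ₑ := by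
      have h := edist_le_range_sum_edist m n
      simpa only [edist_eq_enorm_sub] using h
    calc ‖m 0 - m n‖ₑ * W ≤ (∑ k ∈ Finset.range n, ‖m k - m (k + 1)‖ₑ) * W := by gcongr
      _ = ∑ k ∈ Finset.range n, ‖m k - m (k + 1)‖ₑ * W := Finset.sum_mul _ _ _
      _ ≤ ∑ k ∈ Finset.range n, 4 * C * ENNReal.ofReal R * L * ((2 : ℝ≥0∞)⁻¹) ^ k :=
          Finset.sum_le_sum fun k hk => hstep k (Finset.mem_range.1 hk)
      _ = 4 * C * ENNReal.ofReal R * L * ∑ k ∈ Finset.range n, ((2 : ℝ≥0∞)⁻¹) ^ k :=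
          (Finset.mul_sum _ _ _).symm
      _ ≤ 4 * C * ENNReal.ofReal R * L * 2 := by gcongr; exact sum_inv_two_pow_le n
      _ = 8 * C * ENNReal.ofReal R * L := by ring
  -- ## the ball `B_R` itself
  have hf0 : MemLp f 2 (μ 0) := hfk 0 (Nat.zero_le n)
  have hP0 := hC x₀ (r 0) (hrpos 0) f g hf0 (hgk 0 (Nat.zero_le n)) (hWk 0 (Nat.zero_le n))
  have hL0 : eLpNorm g 2 (μ 0) ≤ L := eLpNorm_mono_measure _ (hμmono (Nat.zero_le n))
  have hμ0 : μ 0 = volume.restrict (ball x₀ R) := by simp only [hμ, hr0]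
  have hne : μ 0 ≠ 0 := by
    rw [hμ0, Ne, Measure.restrict_eq_zero]
    exact (measure_ball_pos volume x₀ hR).ne'
  have hconst : eLpNorm (fun _ : EuclideanSpace ℝ (Fin 3) => m 0) 2 (μ 0) = ‖m 0‖ₑ * W := by
    rw [eLpNorm_const _ two_ne_zero hne, hμ0, Measure.restrict_apply_univ, hWdef]
    norm_num
  have hsplit : eLpNorm f 2 (μ 0) ≤
      eLpNorm (fun x => f x - m 0) 2 (μ 0) + eLpNorm (fun _ : EuclideanSpace ℝ (Fin 3) => m 0) 2 (μ 0) := by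
    have h := eLpNorm_add_le (μ := μ 0) (p := 2) (hf0.1.sub aestronglyMeasurable_const)
      aestronglyMeasurable_const one_le_two (f := fun x => f x - m 0)
      (g := fun _ : EuclideanSpace ℝ (Fin 3) => m 0)
    have e : (fun x => f x - m 0) + (fun _ : EuclideanSpace ℝ (Fin 3) => m 0) = f := by
      funext x; simp
    rwa [e] at h
  -- ## assemble
  rw [← hμ0]
  calc eLpNorm f 2 (μ 0)
      ≤ eLpNorm (fun x => f x - m 0) 2 (μ 0) + ‖m 0‖ₑ * W := by rw [← hconst]; exact hsplit
    _ ≤ C * ENNReal.ofReal (r 0) * eLpNorm g 2 (μ 0) + (‖m 0 - m n‖ₑ + ‖m n‖ₑ) * W := by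
        have hP0' : eLpNorm (fun x => f x - m 0) 2 (μ 0) ≤ C * ENNReal.ofReal (r 0) * eLpNorm g 2 (μ 0) :=
          hP0
        have htri : ‖m 0‖ₑ ≤ ‖m 0 - m n‖ₑ + ‖m n‖ₑ :=
          calc ‖m 0‖ₑ = ‖(m 0 - m n) + m n‖ₑ := by rw [sub_add_cancel]
            _ ≤ ‖m 0 - m n‖ₑ + ‖m n‖ₑ := enorm_add_le _ _
        gcongr
    _ ≤ C * ENNReal.ofReal R * L + (8 * C * ENNReal.ofReal R * L + ‖m n‖ₑ * W) := by
        rw [hr0, add_mul]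
        gcongr
    _ = 9 * C * ENNReal.ofReal R * L + ‖m n‖ₑ * W := by ring

end Summit.NavierStokesRegularity.NavierStokesRegularity.Theorems.PowerGaugeEulerLiouville.Backward

end
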